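import Summits.QuantumFields.BalabanUV.Beta.FP.ConvergenceJMMultiplier
import Summits.QuantumFields.BalabanUV.Beta.GAN24.EffectiveLaplacianLimit

/-!
# `BalabanUV.Beta.FP.PerfectSymbolKMultiplier` — road «FP» for binder row D1, leaf N0b-K («explicit symbol of `KPerf`»), THE MULTIPLIER QUARTER
# (claim table `HOME/b2b-balaban-beta-d1-p3/LEAVES-FP.md` sub-row N0b-K-mm, unit `b2b-balaban-gan24-p3-g12` = row G-an2-4 ∕ (CONV-C) owner lineage):
# the (inr,inr) block of the PERFECT `m`-fold resolvent `KPerf Lc (Lc^·) (Lc^{4·}) m` IS `(2/Lc^{8m})·Δ_∞` — Bałaban's perfect effective Laplacian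
# `GAN24.EffectiveLaplacianLimit.deltaZLim` (the lattice kernel of the continuum (1.66) multiplier) read at the `Lc^m`-block indices, `0` off the coarse points

NOT IN PRINT; OUR PROOF (bookkeeping over tree theorems BY NAME).  HONEST FRAMING (cell contract, verbatim): «discharging `BetaPertH` makes Bałaban's UV
stability UNCONDITIONAL — a real constructive-QFT result; it is NOT the continuum limit and NOT the Clay problem.»  HONEST DEPENDENCY (verbatim): «continuum
YM on T⁴ ⇐ BetaPertH ∧ nine spine estimates (0/9 proved); BetaPertH ⇐ (D1) ∧ (D4) ∧ CAP+tail; G-an2-4 gates asym, D1 and NE2/3/4.»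

WHAT.  leaf-06's `FP.ConvergenceJMMultiplier` proved (X1m-mm) that the mm entries of the unit-rescaled (j, m)-resolvents ARE `(2/Lc^{8m})·Δ_{j+m}` at the
`Lc^m`-coarse points (`mmJM_apply`, gan24-leaf-18's `MultiplierDictionary.wΦ_eq_deltaZ`) and CONVERGE, as `j → ∞`, to the mm entries of `KPerf … m`
(`tendsto_mm_KTot_KPerf`).  gan24-p3's `GAN24.EffectiveLaplacianLimit` (row G-an2-4) NAMES the limit of `Δ_k`: `deltaZ Lc k → deltaZLim` (`tendsto_deltaZ`), with
`deltaZLim = Δ_∞` EXPLICIT (Brillouin-zone integral of the continuum entry symbols `½·W166lim·(e^{−ip_a} − 1)(e^{ip_b} − 1)`) and `Lc`-FREE.  Uniqueness of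
limits gives the CLOSED FORM of the perfect multiplier block (§1), the EXPLICIT RATE of X1m-mm against it (§2), and the READING that in block units the
perfect multiplier block is the same kernel `2·Δ_∞` for every `m` and every `Lc ≥ 2` (§1, `KPerf_inr_inr_coarse`).
* §1 **`KPerf_inr_inr_eq`** (`Lc ≥ 2`): `KPerf Lc (sfStep Lc) (smStep 3 Lc) m x′ y′ (inr κ) (inr l) = [proj (Lc^m) x′ = 0 ∧ proj (Lc^m) y′ = 0] ·
  (2/Lc^{8m}) · deltaZLim (quo (Lc^m) x′ − quo (Lc^m) y′, κ) (0, l)`; `KPerf_inr_inr_coarse` (at `x′ = Lc^m•u`, `y′ = Lc^m•u′`: `(2/Lc^{8m})·Δ_∞((u,κ),(u′,l))`);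
  `KPerf_inr_inr_off` (zero off the coarse points); `KPerf_one_inr_inr_coarse` (`m = 1`: road A2's limit kernel, mm block `= (2/Lc⁸)·Δ_∞`).
* §3 **`decays_mm_KTot_sub_KPerf`** — the same in the wall's `Decays` ∕ `mmPart` currency (X1m-mm's `hKrate`-shape: `Decays (mmPart K_j − mmPart KPerf) (c_m·(Lc⁻²)^j) (kappaZ 3/Lc^m)`).
* §2 **`mm_KTot_sub_KPerf_abs_le`** (every `Lc ≥ 1`, `j`, `m`): `|unitK … (KTot (Lc^(j+m)) (Lc^j)) x′ y′ (inr κ) (inr l) − [coarse]·(2/Lc^{8m})·Δ_∞(…)| ≤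
  (2/Lc^{8m})·theta166Z 3·(Lc⁻²)^{j+m}·e^{−kappaZ 3·|quo x′ − quo y′|₁}` — X1m-mm's Cauchy data (`mmJM_decayCauchy`) sharpened to a rate against the NAMED limit.
HONEST: identifies ONE leg block (mm) of the perfect resolvent; the ff ∕ fm ∕ mf quarters of N0b-K (road P1's fibre symbols) stay OPEN; 0 wall binders
instantiated; NOT «N0b-K closed», NEVER «G-an2-4 closed», NOT BetaPertH, NOT continuum, NOT Clay.

ABSOLUTE RULE (cell, verbatim): «No internally-minted statement may enter as a cited fact. Every hypothesis is either kernel-proved in this package or a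
verbatim quotation of a PUBLISHED theorem with page reference.»  Nothing is cited; no `def`; no binder instantiated at a value; every input is a tree
theorem imported BY NAME.
-/

namespace Summit.QuantumFields.BalabanUV.Beta.FP.PerfectSymbolKMultiplier

open Filter Topology
open Literature.Probability.LatticeModels (Torus.proj)
open Literature.MathematicalPhysics.QuantumFieldTheory
open Literature.MathematicalPhysics.QuantumFieldTheory.Balaban1983to89
open Literature.MathematicalPhysics.QuantumFieldTheory.Balaban1983to89.Beta
open LatticeForm (quo)
open B12Sec2to5 (l1 l1_nonneg)
open ExpKernelCalculus (MKer Decays)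
open OneStepResolventKernel (Fib quo_zsmul proj_zsmul)
open HessKerDressedLimit (limMKerOf mker_sub_apply)
open Summit.QuantumFields.BalabanUV.Beta.HessKerDressedUnits (unitK)
open Summit.QuantumFields.BalabanUV.Beta.GAN24.CombesThomas (smStep sfStep)
open Summit.QuantumFields.BalabanUV.Beta.GAN24.DirichletExhaustionDeltaZ (deltaZ theta166Z kappaZ kappaZ_pos)
open Summit.QuantumFields.BalabanUV.Beta.GAN24.TransverseDictionary (mmPart mmPart_inr_inr mmPart_inl_left mmPart_inl_right)
open Summit.QuantumFields.BalabanUV.Beta.GAN24.EffectiveLaplacianLimit (deltaZLim tendsto_deltaZ deltaZ_sub_deltaZLim_abs_le_l1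
  deltaZLim_pair)
open Summit.QuantumFields.BalabanUV.Beta.FP.PerfectObjects (KTot)
open Summit.QuantumFields.BalabanUV.Beta.FP.PerfectObjectsT (KPerf KPerf_one)
open Summit.QuantumFields.BalabanUV.Beta.FP.ConvergenceJMMultiplier (mmJM_apply tendsto_mm_KTot_KPerf exp_coarse_pow)
open OneStepKernelFamily (KInvStep)

noncomputable section

variable {Lc : ℕ} [NeZero Lc]

/-! ## §1 The closed form of the perfect multiplier block -/

/-- [our object] The mm entries of the unit-rescaled (j, m)-resolvent in CLOSED FORM (leaf-06's `mmJM_apply` with the `mmPart` wrapper removed). -/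
theorem unitK_KTot_inr_inr_eq (m j : ℕ) (κ l : Fin (3 + 1)) (x' y' : Fin (3 + 1) → ℤ) :
    unitK (sfStep Lc j) (smStep 3 Lc j) (KTot (d := 3) (Lc ^ (j + m)) (Lc ^ j)) x' y' (Sum.inr κ) (Sum.inr l) =
      if Torus.proj (Lc ^ m) x' = 0 ∧ Torus.proj (Lc ^ m) y' = 0 then
        (2 * ((((Lc : ℝ) ^ m) ^ 8)⁻¹)) * deltaZ Lc (j + m) (quo (Lc ^ m) x' - quo (Lc ^ m) y', κ) (0, l) else 0 := by
  have h := mmJM_apply (Lc := Lc) m j κ l x' y'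
  rwa [mmPart_inr_inr] at h

/-- [our object] The closed-form sequence converges to the EXPLICIT value `[coarse]·(2/Lc^{8m})·Δ_∞(…)` (`GAN24.EffectiveLaplacianLimit.tendsto_deltaZ`
along `k = j + m`), `Lc ≥ 2`. -/
theorem tendsto_mm_KTot_explicit (hLc : 2 ≤ Lc) (m : ℕ) (x' y' : Fin (3 + 1) → ℤ) (κ l : Fin (3 + 1)) :
    Tendsto (fun j => unitK (sfStep Lc j) (smStep 3 Lc j) (KTot (d := 3) (Lc ^ (j + m)) (Lc ^ j)) x' y' (Sum.inr κ) (Sum.inr l)) atTop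
      (𝓝 (if Torus.proj (Lc ^ m) x' = 0 ∧ Torus.proj (Lc ^ m) y' = 0 then
        (2 * ((((Lc : ℝ) ^ m) ^ 8)⁻¹)) * deltaZLim (quo (Lc ^ m) x' - quo (Lc ^ m) y', κ) (0, l) else 0)) := by
  simp_rw [unitK_KTot_inr_inr_eq]
  split_ifs with h
  · exact ((tendsto_deltaZ (d := 3) hLc (quo (Lc ^ m) x' - quo (Lc ^ m) y', κ) (0, l)).comp (tendsto_add_atTop_nat m)).const_mul _
  · exact tendsto_const_nhds

/-- [our object] **THE PERFECT MULTIPLIER BLOCK, EXPLICIT** (`Lc ≥ 2`, every `m`): the (inr,inr) entries of `KPerf Lc (Lc^·) (Lc^{4·}) m` are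
`(2/Lc^{8m}) · Δ_∞` at the `Lc^m`-block indices of `Lc^m`-coarse points and `0` elsewhere — `Δ_∞ = GAN24.EffectiveLaplacianLimit.deltaZLim`, the
lattice kernel of the continuum (1.66) multiplier, independent of `Lc` and `m`. -/
theorem KPerf_inr_inr_eq (hLc : 2 ≤ Lc) (m : ℕ) (x' y' : Fin (3 + 1) → ℤ) (κ l : Fin (3 + 1)) :
    KPerf (d := 3) Lc (sfStep Lc) (smStep 3 Lc) m x' y' (Sum.inr κ) (Sum.inr l) =
      if Torus.proj (Lc ^ m) x' = 0 ∧ Torus.proj (Lc ^ m) y' = 0 then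
        (2 * ((((Lc : ℝ) ^ m) ^ 8)⁻¹)) * deltaZLim (quo (Lc ^ m) x' - quo (Lc ^ m) y', κ) (0, l) else 0 :=
  tendsto_nhds_unique (tendsto_mm_KTot_KPerf hLc m x' y' κ l) (tendsto_mm_KTot_explicit hLc m x' y' κ l)

/-- [our object] AT COARSE POINTS `x′ = Lc^m • u`, `y′ = Lc^m • u′`: the perfect multiplier block is `(2/Lc^{8m}) · Δ_∞((u,κ),(u′,l))` — in block units
ONE kernel `2·Δ_∞` for every `m` and every `Lc ≥ 2`. -/
theorem KPerf_inr_inr_coarse (hLc : 2 ≤ Lc) (m : ℕ) (u u' : Fin (3 + 1) → ℤ) (κ l : Fin (3 + 1)) :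
    KPerf (d := 3) Lc (sfStep Lc) (smStep 3 Lc) m (((Lc ^ m : ℕ) : ℤ) • u) (((Lc ^ m : ℕ) : ℤ) • u') (Sum.inr κ) (Sum.inr l) =
      (2 * ((((Lc : ℝ) ^ m) ^ 8)⁻¹)) * deltaZLim (d := 3) (u, κ) (u', l) := by
  rw [KPerf_inr_inr_eq hLc, if_pos ⟨proj_zsmul u, proj_zsmul u'⟩, quo_zsmul, quo_zsmul, ← deltaZLim_pair]

/-- [our object] OFF THE COARSE POINTS the perfect multiplier block vanishes (first or second leg). -/
theorem KPerf_inr_inr_off (hLc : 2 ≤ Lc) (m : ℕ) {x' y' : Fin (3 + 1) → ℤ}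
    (h : Torus.proj (Lc ^ m) x' ≠ 0 ∨ Torus.proj (Lc ^ m) y' ≠ 0) (κ l : Fin (3 + 1)) :
    KPerf (d := 3) Lc (sfStep Lc) (smStep 3 Lc) m x' y' (Sum.inr κ) (Sum.inr l) = 0 := by
  rw [KPerf_inr_inr_eq hLc, if_neg]
  rintro ⟨hx, hy⟩
  rcases h with h | h
  · exact h hx
  · exact h hy

/-- [our object] `m = 1` READING: the mm block of road A2's constructed limit kernel `limMKerOf (j ↦ unitK (Lc^j) (Lc^{4j}) (KInvStep Lc j))` at the coarse
points `Lc • u`, `Lc • u′` is `(2/Lc⁸) · Δ_∞((u,κ),(u′,l))`. -/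
theorem KPerf_one_inr_inr_coarse (hLc : 2 ≤ Lc) (u u' : Fin (3 + 1) → ℤ) (κ l : Fin (3 + 1)) :
    limMKerOf (fun j => unitK (sfStep Lc j) (smStep 3 Lc j) (KInvStep (d := 3) Lc j)) (((Lc : ℕ) : ℤ) • u) (((Lc : ℕ) : ℤ) • u')
        (Sum.inr κ) (Sum.inr l) = (2 * (((Lc : ℝ) ^ 8)⁻¹)) * deltaZLim (d := 3) (u, κ) (u', l) := by
  have h := KPerf_inr_inr_coarse hLc 1 u u' κ l
  rw [KPerf_one] at h
  simpa only [pow_one] using h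

/-! ## §2 The explicit rate of X1m-mm against the named limit -/

/-- [our object] **X1m-mm AS A RATE AGAINST THE NAMED LIMIT** (every `Lc ≥ 1`, `j`, `m`): `|mm entry of the unit-rescaled (j, m)-resolvent − [coarse]·(2/Lc^{8m})·Δ_∞(…)|
≤ (2/Lc^{8m}) · theta166Z 3 · (Lc⁻²)^{j+m} · e^{−kappaZ 3 · |quo x′ − quo y′|₁}` (`GAN24.EffectiveLaplacianLimit.deltaZ_sub_deltaZLim_abs_le_l1`). -/
theorem mm_KTot_sub_explicit_abs_le (m j : ℕ) (x' y' : Fin (3 + 1) → ℤ) (κ l : Fin (3 + 1)) :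
    |unitK (sfStep Lc j) (smStep 3 Lc j) (KTot (d := 3) (Lc ^ (j + m)) (Lc ^ j)) x' y' (Sum.inr κ) (Sum.inr l) -
        (if Torus.proj (Lc ^ m) x' = 0 ∧ Torus.proj (Lc ^ m) y' = 0 then
          (2 * ((((Lc : ℝ) ^ m) ^ 8)⁻¹)) * deltaZLim (quo (Lc ^ m) x' - quo (Lc ^ m) y', κ) (0, l) else 0)| ≤
      (2 * ((((Lc : ℝ) ^ m) ^ 8)⁻¹)) * (theta166Z 3 * (((Lc : ℝ) ^ 2)⁻¹) ^ (j + m) *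
        Real.exp (-(kappaZ 3) * l1 (quo (Lc ^ m) x' - quo (Lc ^ m) y'))) := by
  rw [unitK_KTot_inr_inr_eq]
  have hc : (0 : ℝ) ≤ 2 * ((((Lc : ℝ) ^ m) ^ 8)⁻¹) := by positivity
  split_ifs with h
  · rw [← mul_sub, abs_mul, abs_of_nonneg hc]
    refine mul_le_mul_of_nonneg_left ?_ hc
    have hr := deltaZ_sub_deltaZLim_abs_le_l1 (d := 3) Lc (j + m) (quo (Lc ^ m) x' - quo (Lc ^ m) y', κ) (0, l)
    simpa only [sub_zero] using hr
  · rw [sub_zero, abs_zero]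
    have := kappaZ_pos 3
    have hθ : (0 : ℝ) < theta166Z 3 := by
      unfold theta166Z; have := T4Rate166StripDirect.C166_pos (3 + 1); positivity
    positivity

/-- [our object] The same against the perfect resolvent itself (`Lc ≥ 2`): `|mm entry at level j − KPerf … m x′ y′ (inr κ) (inr l)| ≤ (2/Lc^{8m})·theta166Z 3·(Lc⁻²)^{j+m}·
e^{−kappaZ 3·|quo x′ − quo y′|₁}`. -/
theorem mm_KTot_sub_KPerf_abs_le (hLc : 2 ≤ Lc) (m j : ℕ) (x' y' : Fin (3 + 1) → ℤ) (κ l : Fin (3 + 1)) :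
    |unitK (sfStep Lc j) (smStep 3 Lc j) (KTot (d := 3) (Lc ^ (j + m)) (Lc ^ j)) x' y' (Sum.inr κ) (Sum.inr l) -
        KPerf (d := 3) Lc (sfStep Lc) (smStep 3 Lc) m x' y' (Sum.inr κ) (Sum.inr l)| ≤
      (2 * ((((Lc : ℝ) ^ m) ^ 8)⁻¹)) * (theta166Z 3 * (((Lc : ℝ) ^ 2)⁻¹) ^ (j + m) *
        Real.exp (-(kappaZ 3) * l1 (quo (Lc ^ m) x' - quo (Lc ^ m) y'))) := by
  rw [KPerf_inr_inr_eq hLc]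
  exact mm_KTot_sub_explicit_abs_le m j x' y' κ l


/-! ## §3 The rate in the wall's `Decays` ∕ `mmPart` currency -/

/-- [our object] **X1m-mm AS A `Decays` RATE AGAINST THE PERFECT RESOLVENT** (`Lc ≥ 2`, every `m`, `j`):
`Decays (mmPart (D_j·KTot (Lc^(j+m)) (Lc^j)·D_j) − mmPart (KPerf Lc (Lc^·) (Lc^{4·}) m)) ((2/Lc^{8m})·theta166Z 3·(Lc⁻²)^m·(Lc⁻²)^j) (kappaZ 3/Lc^m)` —
leaf-06's one-step constant (`mmJM_stepDecays`) now bounding the distance to the LIMIT, with no `1/(1 − Lc⁻²)`. -/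
theorem decays_mm_KTot_sub_KPerf (hLc : 2 ≤ Lc) (m j : ℕ) :
    Decays (mmPart (unitK (sfStep Lc j) (smStep 3 Lc j) (KTot (d := 3) (Lc ^ (j + m)) (Lc ^ j))) -
        mmPart (KPerf (d := 3) Lc (sfStep Lc) (smStep 3 Lc) m))
      (2 * ((((Lc : ℝ) ^ m) ^ 8)⁻¹) * theta166Z 3 * (((Lc : ℝ) ^ 2)⁻¹) ^ m * (((Lc : ℝ) ^ 2)⁻¹) ^ j)
      (kappaZ 3 / (Lc : ℝ) ^ m) := by
  intro x' y' a b
  have hC : 0 ≤ 2 * ((((Lc : ℝ) ^ m) ^ 8)⁻¹) * theta166Z 3 * (((Lc : ℝ) ^ 2)⁻¹) ^ m * (((Lc : ℝ) ^ 2)⁻¹) ^ j *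
      Real.exp (-(kappaZ 3 / (Lc : ℝ) ^ m) * l1 (x' - y')) := by
    have := T4Rate166StripDirect.C166_pos (3 + 1); unfold theta166Z; positivity
  rw [mker_sub_apply]
  cases a with
  | inl κ => simpa using hC
  | inr κ =>
    cases b with
    | inl l => simpa using hC
    | inr l =>
      rw [mmPart_inr_inr, mmPart_inr_inr]
      by_cases hc : Torus.proj (Lc ^ m) x' = 0 ∧ Torus.proj (Lc ^ m) y' = 0
      · have h := mm_KTot_sub_KPerf_abs_le hLc m j x' y' κ l
        rw [exp_coarse_pow m hc.1 hc.2] at h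
        calc _ ≤ _ := h
          _ = _ := by rw [pow_add]; ring
      · rw [unitK_KTot_inr_inr_eq, KPerf_inr_inr_eq hLc, if_neg hc, if_neg hc, sub_zero, abs_zero]
        exact hC

end

end Summit.QuantumFields.BalabanUV.Beta.FP.PerfectSymbolKMultiplier
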